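import Summits.QuantumFields.BalabanUV.T4Continuum.Support.NE3StraightAverageSplit
import Summits.QuantumFields.BalabanUV.T4Continuum.Support.NE3BlockPoincareCore
import HarnessLib

/-!
# T⁴ programme, node NE3 — row E-MLw-(w4)-P, flat file F2: THE N-FREE S-BOUND `Σ‖(Qcoarse L)^[k] Y‖² ≤ (L^k)^{4−d}·Σ‖∂_κ Y_κ‖²`
# ON `ker Tcoarse^[k] ∩ {flatDiv = 0}` (constant ONE), AND THE N-FREE BLOCK-POINCARÉ INEQUALITY `Σ‖Y‖² ≤ 9·(L^k)²·Σ‖∂Y‖²`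

NE3 (node U1b), row NE3 OWNER `b2b-balaban-t4-ne3-p1` (gen 21), design ruling D-ne3p1-g21-1 (journal l.15420) §1 (VI)–(VII);
on F1 = `NE3StraightAverageAdjoint` + `NE3StraightAverageSplit` and on leaf-04-g4's `NE3BlockPoincareCore`.

WHAT.  leaf-04's `sum_norm_sq_le_of_iterate_Tcoarse_eq_zero` bounds `Σ‖Y‖²` on the k-fold flat tangent space by
`(5 + 2d·N²)·(L^k)²·Σ‖∂Y‖²` (the `N²` from route (C1), the coarse torus Poincaré inequality for exact 1-forms).  Under the flat
LANDAU condition the `N²` disappears: the straight average `S = dPot μ` obeys the S-BOUND `Σ‖S‖² ≤ M^{4−d}·G_diag` (`M = L^k`),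
by the adjoint–spline–Landau pairing of F1 (`Σ‖T‖² = M^d·Σ⟪S,T⟫ = M^d·Σ⟪Wad S, Y⟫ = −M^d·Σ⟪hsp S, ∂^*Y⟫ + 0`) and
Cauchy–Schwarz — no estimate of the frame potential `μ`, no inversion of a coarse operator (the holonomy-robust template of the
curved core); feeding it into leaf-04's core (steps (1)(2) copied for a general block side, step (3) replaced) gives constant `9`.

CONTENT ([folklore]; 0 sorry; 0 def):
§1 **`sum_norm_sq_le_of_lineSum_sq_le`** — the core for a general block side `M ≥ 1`: if the line sums obey
   `Σ_z Σ_κ ‖T z κ‖² ≤ Θ·M^{d+4}·G` then `Σ‖Y‖² ≤ (5 + 4Θ)·M²·G` (adapted from leaf-04-g4 `NE3BlockPoincareCore`, steps (1)(2)(4));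
§2 **`lineSum_sq_le_of_exact_of_flatDiv`** — the S-bound in line-sum form, `Θ = 1`: exact line sums `T = M^d•dPot μ`
   (`μ` `N`-periodic) and flat-divergence-free `Y` ⇒ `Σ‖T‖² ≤ M^{d+4}·Σ_x Σ_κ ‖Y x κ − Y(x−e_κ) κ‖²`;
§3 **`sum_norm_sq_le_of_iterate_Tcoarse_eq_zero_of_flatDiv`** — THE END (complex values): `L, N ≥ 1`, `Y` `(L^k·N)`-periodic
   with `(Tcoarse L)^[k] Y = 0` and `Σ_κ (Y x κ − Y (x−e_κ) κ) = 0` ⇒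
   `Σ_x Σ_κ ‖Y x κ‖² ≤ 9·(L^k)²·Σ_x Σ_κ Σ_μ ‖Y(x+e_μ) κ − Y x κ‖²` over `periodBox (L^k·N)` — N-FREE, k-free, L-free.
(The S-bound in leaf-04's `Qcoarse` currency, the matrix ∕ `dirSq` wrappers and (P_1) on `flatTangentLandau` — leaf-04 (C2b) ∕
leaf-02-g4's assembly with `5 + 2dN²` replaced by `9` — are the companion file `NE3BlockPoincareLandauEnd`.)

HONEST FRAMING.  A theorem about OUR typed objects at the FLAT configuration; (P_W) at the curved background, (ML_w), T-E_w and
NE3 are NOT proved; nothing about Bałaban's minimisers; spine PROVED 0∕9; finite T⁴ rung (B)+1 — NOT infinite volume, NOT mass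
gap, NOT BetaPertH, NOT Clay.  ABSOLUTE RULE kept (nothing printed is a hypothesis; context: [Balaban1985PropagatorsII] Thm 3.3
(3.46)).  PLACEMENT: `Summits/QuantumFields/BalabanUV/`; imports accepted modules only.
-/

set_option autoImplicit false

open scoped BigOperators InnerProductSpace
open Finset

namespace Summit.QuantumFields.BalabanUV.T4Continuum.NE3BlockPoincareLandau

open Literature.MathematicalPhysics.QuantumFieldTheory.Balaban1983to89
open B7Prop1Explicit
open T4AveragingDeficitWallBoundary (periodBox mem_periodBox card_periodBox sum_periodBox_shift)
open NE3TangentNoGoWords (dPot)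
open SmoothRefineNeutral (Tcoarse)
open NE3TangentFlatStructure (Qcoarse framePot iterate_Tcoarse_eq_zero_iff framePot_add_period)
open NE3BlockLineAverage (iterate_Qcoarse_apply sum_periodBox_blocks norm_lineMean_sub_blockMean_sq_le)
open NE3CoarseTorusExact (sum_norm_sub_blockMean_sq_le sum_periodBox_sub_e)
open NE3BlockPoincareCore (sum_norm_sq_le_of_mean norm_sq_le_two_mul sum_rotate3 sum_blocks_torus sum_blocks_torus_shift)
open NE3StraightAverageAdjoint (Wad cdiv_cmod_block sum_inner_lineSum_eq_sum_inner_Wad)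
open NE3StraightAverageSplit (hsp Jmp Wad_eq norm_hsp_le sum_inner_fd_eq_neg hsp_periodic sum_inner_Jmp_dPot_eq_zero)
open SkeletonLattice (cdiv cmod)

noncomputable section

variable {d : ℕ}

/-! ## §1 The core for a general block side: line sums bounded by gradients ⇒ Poincaré -/
/-- **THE CORE OF THE BLOCK-POINCARÉ INEQUALITY, GENERAL BLOCK SIDE** (complex values; leaf-04-g4's steps (1)(2)(4) with the
block side `M` in place of `L^k` and step (3) replaced by a hypothesis): `M, N ≥ 1`, `Y` an `(M·N)`-periodic complex 1-cochain
whose line sums obey `Σ_z Σ_κ ‖T z κ‖² ≤ Θ·M^{d+4}·G` (`G` = full gradient).  Then `Σ‖Y‖² ≤ (5 + 4Θ)·M²·G`.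
(adapted from `NE3BlockPoincareCore.sum_norm_sq_le_of_lineMean_bound`.) [folklore] -/
theorem sum_norm_sq_le_of_lineSum_sq_le {M : ℕ} (hM : 1 ≤ M) {N : ℕ} (hN : 1 ≤ N) (Y : Site d → Fin d → ℂ)
    (hY : ∀ (x : Site d) (τ μ : Fin d), Y (x + ((M * N : ℕ) : ℤ) • e τ) μ = Y x μ) {Θ : ℝ}
    (hT : ∑ z ∈ periodBox (d := d) N, ∑ κ : Fin d,
        ‖∑ v ∈ periodBox (d := d) M, ∑ i ∈ range M, Y ((M : ℤ) • z + v + (i : ℤ) • e κ) κ‖ ^ 2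
      ≤ Θ * ((M : ℝ) ^ d * (M : ℝ) ^ 4)
          * ∑ x ∈ periodBox (d := d) (M * N), ∑ κ : Fin d, ∑ μ : Fin d, ‖Y (x + e μ) κ - Y x κ‖ ^ 2) :
    ∑ x ∈ periodBox (d := d) (M * N), ∑ κ : Fin d, ‖Y x κ‖ ^ 2
      ≤ (5 + 4 * Θ) * (M : ℝ) ^ 2
          * ∑ x ∈ periodBox (d := d) (M * N), ∑ κ : Fin d, ∑ μ : Fin d, ‖Y (x + e μ) κ - Y x κ‖ ^ 2 := by
  have hM0 : (0 : ℝ) < M := by exact_mod_cast (by omega : 0 < M)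
  set B : Finset (Site d) := periodBox (d := d) M with hBdef
  have hcardB : (B.card : ℝ) = (M : ℝ) ^ d := by rw [hBdef, card_periodBox]; push_cast; ring
  set g : Fin d → Site d → ℝ := fun κ x => ‖Y (x + e κ) κ - Y x κ‖ ^ 2 with hgdef
  set G : ℝ := ∑ x ∈ periodBox (d := d) (M * N), ∑ κ : Fin d, ∑ μ : Fin d, ‖Y (x + e μ) κ - Y x κ‖ ^ 2 with hGdef
  have hG0 : 0 ≤ G := by positivity
  have hgper : ∀ (κ : Fin d) (x : Site d) (τ : Fin d), g κ (x + ((M * N : ℕ) : ℤ) • e τ) = g κ x := by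
    intro κ x τ
    simp only [hgdef]
    rw [add_right_comm, hY, hY]
  have hdiag : ∑ κ : Fin d, ∑ x ∈ periodBox (d := d) (M * N), g κ x ≤ G := by
    rw [hGdef, Finset.sum_comm]
    refine Finset.sum_le_sum fun x _ => Finset.sum_le_sum fun κ _ => ?_
    exact Finset.single_le_sum (f := fun μ => ‖Y (x + e μ) κ - Y x κ‖ ^ 2) (fun _ _ => sq_nonneg _) (Finset.mem_univ κ)
  set T : Site d → Fin d → ℂ := fun z κ => ∑ v ∈ B, ∑ i ∈ range M, Y ((M : ℤ) • z + v + (i : ℤ) • e κ) κ with hTdef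
  -- (1) per block and component: oscillation + mean
  have hblock : ∀ (z : Site d) (κ : Fin d),
      (M : ℝ) ^ 2 * (M : ℝ) ^ d * ∑ v ∈ B, ‖Y ((M : ℤ) • z + v) κ‖ ^ 2
        ≤ (M : ℝ) ^ 2 * (M : ℝ) ^ d * ((M : ℝ) ^ 2 * ∑ v ∈ B, ∑ μ : Fin d, ‖Y ((M : ℤ) • z + v + e μ) κ - Y ((M : ℤ) • z + v) κ‖ ^ 2)
          + 4 * ((M : ℝ) ^ 2 * ((M : ℝ) ^ d * M)
              * ∑ v ∈ B, ∑ j ∈ range M, ‖Y ((M : ℤ) • z + v + ((j : ℤ) + 1) • e κ) κ - Y ((M : ℤ) • z + v + (j : ℤ) • e κ) κ‖ ^ 2)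
          + 4 * ‖T z κ‖ ^ 2 := by
    intro z κ
    set q : Site d := (M : ℤ) • z with hq
    set A : ℂ := ∑ v ∈ B, Y (q + v) κ with hA
    have hosc := sum_norm_sub_blockMean_sq_le hM (fun x => Y x κ) q
    have hmean := sum_norm_sq_le_of_mean B (fun v => Y (q + v) κ) (A / ((M : ℂ) ^ d))
    have hnormm : (B.card : ℝ) * ‖A / ((M : ℂ) ^ d)‖ ^ 2 = ‖A‖ ^ 2 / (M : ℝ) ^ d := by
      rw [norm_div, norm_pow, Complex.norm_natCast, hcardB, div_pow]
      field_simp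
    have hline := norm_lineMean_sub_blockMean_sq_le Y q κ B M
    have hA2 : (M : ℝ) ^ 2 * ‖A‖ ^ 2 ≤ 2 * ‖T z κ - (M : ℝ) • A‖ ^ 2 + 2 * ‖T z κ‖ ^ 2 := by
      have h := norm_sq_le_two_mul ((M : ℝ) • A) (T z κ)
      rw [norm_smul, Real.norm_eq_abs, abs_of_pos hM0, mul_pow, norm_sub_rev] at h
      exact h
    have hTA : ‖T z κ - (M : ℝ) • A‖ ^ 2
        ≤ (M : ℝ) ^ 2 * (B.card * M)
            * ∑ v ∈ B, ∑ j ∈ range M, ‖Y (q + v + ((j : ℤ) + 1) • e κ) κ - Y (q + v + (j : ℤ) • e κ) κ‖ ^ 2 := by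
      simpa only [hTdef, hA] using hline
    rw [hcardB] at hTA
    have hMd0 : (0 : ℝ) < (M : ℝ) ^ d := by positivity
    have step1 : (M : ℝ) ^ 2 * (M : ℝ) ^ d * ∑ v ∈ B, ‖Y (q + v) κ‖ ^ 2
        ≤ (M : ℝ) ^ 2 * (M : ℝ) ^ d * (2 * ∑ v ∈ B, ‖Y (q + v) κ - A / ((M : ℂ) ^ d)‖ ^ 2) + 2 * ((M : ℝ) ^ 2 * ‖A‖ ^ 2) := by
      have := mul_le_mul_of_nonneg_left hmean (le_of_lt (mul_pos (pow_pos hM0 2) hMd0))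
      refine this.trans (le_of_eq ?_)
      rw [mul_add, mul_assoc (2 : ℝ) (B.card : ℝ), hnormm]
      field_simp
    have step2 : (M : ℝ) ^ 2 * (M : ℝ) ^ d * (2 * ∑ v ∈ B, ‖Y (q + v) κ - A / ((M : ℂ) ^ d)‖ ^ 2)
        ≤ (M : ℝ) ^ 2 * (M : ℝ) ^ d * ((M : ℝ) ^ 2 * ∑ v ∈ B, ∑ μ : Fin d, ‖Y (q + v + e μ) κ - Y (q + v) κ‖ ^ 2) := by
      refine mul_le_mul_of_nonneg_left ?_ (le_of_lt (mul_pos (pow_pos hM0 2) hMd0))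
      linarith [hosc]
    nlinarith [step1, step2, hA2, hTA, norm_nonneg (T z κ)]
  -- (2) sum over blocks and components
  have hsumY : ∑ z ∈ periodBox (d := d) N, ∑ κ : Fin d, ∑ v ∈ B, ‖Y ((M : ℤ) • z + v) κ‖ ^ 2
      = ∑ x ∈ periodBox (d := d) (M * N), ∑ κ : Fin d, ‖Y x κ‖ ^ 2 := by
    rw [← sum_blocks_torus hM N (fun x => ∑ κ : Fin d, ‖Y x κ‖ ^ 2)]
    exact Finset.sum_congr rfl fun z _ => Finset.sum_comm
  have hsumOsc : ∑ z ∈ periodBox (d := d) N, ∑ κ : Fin d,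
        ∑ v ∈ B, ∑ μ : Fin d, ‖Y ((M : ℤ) • z + v + e μ) κ - Y ((M : ℤ) • z + v) κ‖ ^ 2 = G := by
    rw [hGdef, ← sum_blocks_torus hM N (fun x => ∑ κ : Fin d, ∑ μ : Fin d, ‖Y (x + e μ) κ - Y x κ‖ ^ 2)]
    exact Finset.sum_congr rfl fun z _ => Finset.sum_comm
  have hsumSeg : ∑ z ∈ periodBox (d := d) N, ∑ κ : Fin d,
        ∑ v ∈ B, ∑ j ∈ range M, ‖Y ((M : ℤ) • z + v + ((j : ℤ) + 1) • e κ) κ - Y ((M : ℤ) • z + v + (j : ℤ) • e κ) κ‖ ^ 2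
      ≤ M * G := by
    calc ∑ z ∈ periodBox (d := d) N, ∑ κ : Fin d,
          ∑ v ∈ B, ∑ j ∈ range M, ‖Y ((M : ℤ) • z + v + ((j : ℤ) + 1) • e κ) κ - Y ((M : ℤ) • z + v + (j : ℤ) • e κ) κ‖ ^ 2
        = ∑ κ : Fin d, ∑ z ∈ periodBox (d := d) N, ∑ v ∈ B, ∑ j ∈ range M, g κ ((M : ℤ) • z + v + (j : ℤ) • e κ) := by
          rw [Finset.sum_comm]
          refine Finset.sum_congr rfl fun κ _ => Finset.sum_congr rfl fun z _ => Finset.sum_congr rfl fun v _ =>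
            Finset.sum_congr rfl fun j _ => ?_
          simp only [hgdef, add_one_zsmul, add_assoc]
      _ = ∑ κ : Fin d, ∑ j ∈ range M, ∑ z ∈ periodBox (d := d) N, ∑ v ∈ B, g κ ((M : ℤ) • z + v + (j : ℤ) • e κ) :=
          Finset.sum_congr rfl fun κ _ => sum_rotate3 _ _ _ _
      _ = ∑ κ : Fin d, ∑ _j ∈ range M, ∑ x ∈ periodBox (d := d) (M * N), g κ x := by
          refine Finset.sum_congr rfl fun κ _ => Finset.sum_congr rfl fun j _ => ?_
          exact sum_blocks_torus_shift hM hN (hgper κ) _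
      _ = M * ∑ κ : Fin d, ∑ x ∈ periodBox (d := d) (M * N), g κ x := by
          rw [Finset.mul_sum]
          refine Finset.sum_congr rfl fun κ _ => ?_
          rw [Finset.sum_const, card_range, nsmul_eq_mul]
      _ ≤ M * G := mul_le_mul_of_nonneg_left hdiag (Nat.cast_nonneg M)
  -- (4) conclude
  have hfinal : (M : ℝ) ^ 2 * (M : ℝ) ^ d * ∑ x ∈ periodBox (d := d) (M * N), ∑ κ : Fin d, ‖Y x κ‖ ^ 2
      ≤ (M : ℝ) ^ 2 * (M : ℝ) ^ d * ((5 + 4 * Θ) * (M : ℝ) ^ 2 * G) := by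
    have hsum := Finset.sum_le_sum fun z (_ : z ∈ periodBox (d := d) N) =>
      Finset.sum_le_sum fun κ (_ : κ ∈ (Finset.univ : Finset (Fin d))) => hblock z κ
    rw [← hsumY]
    simp only [Finset.sum_add_distrib, ← Finset.mul_sum] at hsum
    refine hsum.trans ?_
    rw [hsumOsc]
    have e1 : 4 * ((M : ℝ) ^ 2 * ((M : ℝ) ^ d * M) * ∑ z ∈ periodBox (d := d) N, ∑ κ : Fin d,
          ∑ v ∈ B, ∑ j ∈ range M, ‖Y ((M : ℤ) • z + v + ((j : ℤ) + 1) • e κ) κ - Y ((M : ℤ) • z + v + (j : ℤ) • e κ) κ‖ ^ 2)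
        ≤ 4 * ((M : ℝ) ^ 2 * ((M : ℝ) ^ d * M) * (M * G)) :=
      mul_le_mul_of_nonneg_left (mul_le_mul_of_nonneg_left hsumSeg (by positivity)) (by norm_num)
    have e2 : 4 * ∑ z ∈ periodBox (d := d) N, ∑ κ : Fin d, ‖T z κ‖ ^ 2 ≤ 4 * (Θ * ((M : ℝ) ^ d * (M : ℝ) ^ 4) * G) :=
      mul_le_mul_of_nonneg_left hT (by norm_num)
    have e3 : (M : ℝ) ^ 2 * (M : ℝ) ^ d * ((M : ℝ) ^ 2 * G) + 4 * ((M : ℝ) ^ 2 * ((M : ℝ) ^ d * M) * (M * G))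
        + 4 * (Θ * ((M : ℝ) ^ d * (M : ℝ) ^ 4) * G)
        = (M : ℝ) ^ 2 * (M : ℝ) ^ d * ((5 + 4 * Θ) * (M : ℝ) ^ 2 * G) := by ring
    linarith [e1, e2, e3]
  have hpos : (0 : ℝ) < (M : ℝ) ^ 2 * (M : ℝ) ^ d := by positivity
  exact le_of_mul_le_mul_left hfinal hpos

/-! ## §2 The N-free S-bound: exact line sums + flat Landau ⇒ `Σ‖T‖² ≤ M^{d+4}·G_diag` -/

/-- The coboundary of a periodic coarse function is periodic. [folklore] -/
theorem dPot_periodic {N : ℕ} {μ : Site d → ℂ} (hμ : ∀ (z : Site d) (τ : Fin d), μ (z + (N : ℤ) • e τ) = μ z)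
    (z : Site d) (τ κ : Fin d) : dPot μ (z + (N : ℤ) • e τ) κ = dPot μ z κ := by
  simp only [dPot]
  rw [add_right_comm, hμ, hμ]

/-- `Σ_{x∈periodBox(M·N)} f (cdiv M x) = M^d·Σ_{z∈periodBox N} f z`. [folklore] -/
theorem sum_comp_cdiv {M : ℕ} (hM : 1 ≤ M) (N : ℕ) (f : Site d → ℝ) :
    ∑ x ∈ periodBox (d := d) (M * N), f (cdiv M x) = (M : ℝ) ^ d * ∑ z ∈ periodBox (d := d) N, f z := by
  rw [← sum_blocks_torus hM N (fun x => f (cdiv M x)), Finset.mul_sum]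
  refine Finset.sum_congr rfl fun z _ => ?_
  rw [Finset.sum_congr rfl fun v hv => by rw [(cdiv_cmod_block (M := M) (z := z) hv).1], Finset.sum_const, card_periodBox,
    nsmul_eq_mul]
  push_cast; ring

/-- Arithmetic of the S-bound: `A = m²Ω ≤ m·c·P`, `P² ≤ Q·G`, `Q ≤ 4mΩ` ⇒ `A ≤ 4c²·m·G`. [folklore] -/
theorem sbound_arith {A Ω P Q G m c : ℝ} (hm : 0 < m) (hA0 : 0 ≤ A) (hG : 0 ≤ G)
    (hAΩ : A = m ^ 2 * Ω) (hAP : A ≤ m * c * P) (hP2 : P ^ 2 ≤ Q * G) (hQ : Q ≤ 4 * m * Ω) :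
    A ≤ 4 * c ^ 2 * m * G := by
  have hΩ : Ω = A / m ^ 2 := by rw [hAΩ]; field_simp
  have h1 : A ^ 2 ≤ (m * c) ^ 2 * P ^ 2 := by
    have h := pow_le_pow_left₀ hA0 hAP 2
    have h' : (m * c * P) ^ 2 = (m * c) ^ 2 * P ^ 2 := by ring
    rw [h'] at h; exact h
  have h2 : (m * c) ^ 2 * P ^ 2 ≤ (m * c) ^ 2 * (Q * G) := mul_le_mul_of_nonneg_left hP2 (by positivity)
  have h3 : (m * c) ^ 2 * (Q * G) ≤ (m * c) ^ 2 * ((4 * m * Ω) * G) :=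
    mul_le_mul_of_nonneg_left (mul_le_mul_of_nonneg_right hQ hG) (by positivity)
  have h4 : (m * c) ^ 2 * ((4 * m * Ω) * G) = (4 * c ^ 2 * m * G) * A := by rw [hΩ]; field_simp
  have hsq : A ^ 2 ≤ (4 * c ^ 2 * m * G) * A := by linarith [h1, h2, h3, h4]
  by_contra hle
  have hlt : 4 * c ^ 2 * m * G < A := lt_of_not_ge hle
  have hApos : 0 < A := lt_of_le_of_lt (by positivity) hlt
  have : (4 * c ^ 2 * m * G) * A < A * A := mul_lt_mul_of_pos_right hlt hApos
  nlinarith [hsq, this]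

/-- **THE N-FREE S-BOUND IN LINE-SUM FORM** (complex values): `M, N ≥ 1`, `μ` an `N`-periodic coarse function, `Y` an
`(M·N)`-periodic fine field whose line sums are EXACT, `Σ_v Σ_{i<M} Y(M•z+v+i e_κ) κ = M^d•(dPot μ z κ)`, and which is
flat-divergence-free, `Σ_κ (Y x κ − Y (x − e_κ) κ) = 0`.  Then
`Σ_z Σ_κ ‖Σ_v Σ_i Y(M•z+v+i e_κ) κ‖² ≤ M^{d+4}·Σ_x Σ_κ ‖Y x κ − Y (x − e_κ) κ‖²`; `μ` is never estimated. [folklore] -/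
theorem lineSum_sq_le_of_exact_of_flatDiv {M : ℕ} (hM : 1 ≤ M) {N : ℕ} (hN : 1 ≤ N) (μ : Site d → ℂ)
    (Y : Site d → Fin d → ℂ) (hμ : ∀ (z : Site d) (τ : Fin d), μ (z + (N : ℤ) • e τ) = μ z)
    (hY : ∀ (x : Site d) (τ μ' : Fin d), Y (x + ((M * N : ℕ) : ℤ) • e τ) μ' = Y x μ')
    (hex : ∀ (z : Site d) (κ : Fin d),
      ∑ v ∈ periodBox (d := d) M, ∑ i ∈ range M, Y ((M : ℤ) • z + v + (i : ℤ) • e κ) κ = ((M : ℝ) ^ d) • dPot μ z κ)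
    (hdiv : ∀ x : Site d, ∑ κ : Fin d, (Y x κ - Y (x - e κ) κ) = 0) :
    ∑ z ∈ periodBox (d := d) N, ∑ κ : Fin d, ‖∑ v ∈ periodBox (d := d) M, ∑ i ∈ range M, Y ((M : ℤ) • z + v + (i : ℤ) • e κ) κ‖ ^ 2
      ≤ (M : ℝ) ^ (d + 4) * ∑ x ∈ periodBox (d := d) (M * N), ∑ κ : Fin d, ‖Y x κ - Y (x - e κ) κ‖ ^ 2 := by
  have hMN : 1 ≤ M * N := Nat.one_le_iff_ne_zero.mpr (Nat.mul_ne_zero (by omega) (by omega))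
  have hMd : (0 : ℝ) < (M : ℝ) ^ d := by positivity
  have hω : ∀ (z : Site d) (τ κ : Fin d), dPot μ (z + (N : ℤ) • e τ) κ = dPot μ z κ := fun z τ κ => dPot_periodic hμ z τ κ
  -- (a) `A = (M^d)²·Ω`
  have hAΩ : ∑ z ∈ periodBox (d := d) N, ∑ κ : Fin d,
        ‖∑ v ∈ periodBox (d := d) M, ∑ i ∈ range M, Y ((M : ℤ) • z + v + (i : ℤ) • e κ) κ‖ ^ 2
      = ((M : ℝ) ^ d) ^ 2 * ∑ z ∈ periodBox (d := d) N, ∑ κ : Fin d, ‖dPot μ z κ‖ ^ 2 := by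
    rw [Finset.mul_sum]
    refine Finset.sum_congr rfl fun z _ => ?_
    rw [Finset.mul_sum]
    refine Finset.sum_congr rfl fun κ _ => ?_
    rw [hex z κ, norm_smul, Real.norm_of_nonneg hMd.le, mul_pow]
  -- (b) the pairing: `A = −M^d · Σ_κ Σ_x ⟪hsp x κ, ∂^*_κ Y_κ x⟫`
  have h2 : ∀ κ : Fin d, ∑ z ∈ periodBox (d := d) N,
      ⟪dPot μ z κ, ∑ v ∈ periodBox (d := d) M, ∑ i ∈ range M, Y ((M : ℤ) • z + v + (i : ℤ) • e κ) κ⟫_ℝ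
      = -∑ x ∈ periodBox (d := d) (M * N), ⟪hsp M (dPot μ) x κ, Y x κ - Y (x - e κ) κ⟫_ℝ
        + ∑ x ∈ periodBox (d := d) (M * N), ⟪Jmp M (dPot μ) x κ, Y x κ⟫_ℝ := by
    intro κ
    rw [sum_inner_lineSum_eq_sum_inner_Wad hM hN κ (dPot μ) Y hω hY,
      ← sum_inner_fd_eq_neg hMN κ (fun x => hsp M (dPot μ) x κ) (fun x => Y x κ)
        (fun x τ => hsp_periodic hM (dPot μ) hω x τ κ) (fun x τ => hY x τ κ), ← Finset.sum_add_distrib]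
    refine Finset.sum_congr rfl fun x _ => ?_
    rw [Wad_eq hM (dPot μ) x κ, ← inner_add_left]
  have h3 : ∑ κ : Fin d, ∑ x ∈ periodBox (d := d) (M * N), ⟪Jmp M (dPot μ) x κ, Y x κ⟫_ℝ = 0 := by
    rw [Finset.sum_comm]
    exact sum_inner_Jmp_dPot_eq_zero hM hN μ Y hμ hY hdiv
  have hpair : ∑ z ∈ periodBox (d := d) N, ∑ κ : Fin d,
        ‖∑ v ∈ periodBox (d := d) M, ∑ i ∈ range M, Y ((M : ℤ) • z + v + (i : ℤ) • e κ) κ‖ ^ 2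
      = (M : ℝ) ^ d * ∑ κ : Fin d, ∑ x ∈ periodBox (d := d) (M * N),
          -⟪hsp M (dPot μ) x κ, Y x κ - Y (x - e κ) κ⟫_ℝ := by
    have h1 : ∑ z ∈ periodBox (d := d) N, ∑ κ : Fin d,
          ‖∑ v ∈ periodBox (d := d) M, ∑ i ∈ range M, Y ((M : ℤ) • z + v + (i : ℤ) • e κ) κ‖ ^ 2
        = (M : ℝ) ^ d * ∑ κ : Fin d, ∑ z ∈ periodBox (d := d) N,
          ⟪dPot μ z κ, ∑ v ∈ periodBox (d := d) M, ∑ i ∈ range M, Y ((M : ℤ) • z + v + (i : ℤ) • e κ) κ⟫_ℝ := by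
      rw [Finset.sum_comm, Finset.mul_sum]
      refine Finset.sum_congr rfl fun κ _ => ?_
      rw [Finset.mul_sum]
      refine Finset.sum_congr rfl fun z _ => ?_
      rw [← real_inner_self_eq_norm_sq]
      conv_lhs => rw [hex z κ]
      rw [real_inner_smul_left, hex z κ]
    rw [h1]
    simp_rw [h2]
    rw [Finset.sum_add_distrib, h3, add_zero]
    congr 1
    refine Finset.sum_congr rfl fun κ _ => ?_
    rw [Finset.sum_neg_distrib]
  -- (c) termwise bound
  have hterm : ∀ (κ : Fin d) (x : Site d), -⟪hsp M (dPot μ) x κ, Y x κ - Y (x - e κ) κ⟫_ℝ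
      ≤ (M : ℝ) ^ 2 / 2 * ((‖dPot μ (cdiv M x) κ‖ + ‖dPot μ (cdiv M x - e κ) κ‖) * ‖Y x κ - Y (x - e κ) κ‖) := by
    intro κ x
    have h1 := neg_le_abs (⟪hsp M (dPot μ) x κ, Y x κ - Y (x - e κ) κ⟫_ℝ)
    have h2 := abs_real_inner_le_norm (hsp M (dPot μ) x κ) (Y x κ - Y (x - e κ) κ)
    have h3 := mul_le_mul_of_nonneg_right (norm_hsp_le hM (dPot μ) x κ) (norm_nonneg (Y x κ - Y (x - e κ) κ))
    linarith
  have hAP : ∑ z ∈ periodBox (d := d) N, ∑ κ : Fin d,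
        ‖∑ v ∈ periodBox (d := d) M, ∑ i ∈ range M, Y ((M : ℤ) • z + v + (i : ℤ) • e κ) κ‖ ^ 2
      ≤ (M : ℝ) ^ d * ((M : ℝ) ^ 2 / 2) * ∑ κ : Fin d, ∑ x ∈ periodBox (d := d) (M * N),
          (‖dPot μ (cdiv M x) κ‖ + ‖dPot μ (cdiv M x - e κ) κ‖) * ‖Y x κ - Y (x - e κ) κ‖ := by
    rw [hpair, mul_assoc]
    refine mul_le_mul_of_nonneg_left ?_ hMd.le
    rw [Finset.mul_sum]
    refine Finset.sum_le_sum fun κ _ => ?_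
    rw [Finset.mul_sum]
    exact Finset.sum_le_sum fun x _ => hterm κ x
  -- (d) Cauchy–Schwarz and the value count
  have hP2 : (∑ κ : Fin d, ∑ x ∈ periodBox (d := d) (M * N),
          (‖dPot μ (cdiv M x) κ‖ + ‖dPot μ (cdiv M x - e κ) κ‖) * ‖Y x κ - Y (x - e κ) κ‖) ^ 2
      ≤ (∑ κ : Fin d, ∑ x ∈ periodBox (d := d) (M * N), (‖dPot μ (cdiv M x) κ‖ + ‖dPot μ (cdiv M x - e κ) κ‖) ^ 2)
        * ∑ x ∈ periodBox (d := d) (M * N), ∑ κ : Fin d, ‖Y x κ - Y (x - e κ) κ‖ ^ 2 := by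
    rw [Finset.sum_comm (s := periodBox (d := d) (M * N)) (t := (Finset.univ : Finset (Fin d))),
      ← Finset.sum_product' (s := (Finset.univ : Finset (Fin d))) (t := periodBox (d := d) (M * N))
        (f := fun κ x => (‖dPot μ (cdiv M x) κ‖ + ‖dPot μ (cdiv M x - e κ) κ‖) * ‖Y x κ - Y (x - e κ) κ‖),
      ← Finset.sum_product' (f := fun κ x => (‖dPot μ (cdiv M x) κ‖ + ‖dPot μ (cdiv M x - e κ) κ‖) ^ 2),
      ← Finset.sum_product' (f := fun κ x => ‖Y x κ - Y (x - e κ) κ‖ ^ 2)]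
    exact Finset.sum_mul_sq_le_sq_mul_sq _ _ _
  have hQ : ∑ κ : Fin d, ∑ x ∈ periodBox (d := d) (M * N), (‖dPot μ (cdiv M x) κ‖ + ‖dPot μ (cdiv M x - e κ) κ‖) ^ 2
      ≤ 4 * (M : ℝ) ^ d * ∑ z ∈ periodBox (d := d) N, ∑ κ : Fin d, ‖dPot μ z κ‖ ^ 2 := by
    have hpt : ∀ (κ : Fin d) (x : Site d), (‖dPot μ (cdiv M x) κ‖ + ‖dPot μ (cdiv M x - e κ) κ‖) ^ 2
        ≤ 2 * ‖dPot μ (cdiv M x) κ‖ ^ 2 + 2 * ‖dPot μ (cdiv M x - e κ) κ‖ ^ 2 := by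
      intro κ x
      nlinarith [sq_nonneg (‖dPot μ (cdiv M x) κ‖ - ‖dPot μ (cdiv M x - e κ) κ‖)]
    calc ∑ κ : Fin d, ∑ x ∈ periodBox (d := d) (M * N), (‖dPot μ (cdiv M x) κ‖ + ‖dPot μ (cdiv M x - e κ) κ‖) ^ 2
        ≤ ∑ κ : Fin d, ∑ x ∈ periodBox (d := d) (M * N),
            (2 * ‖dPot μ (cdiv M x) κ‖ ^ 2 + 2 * ‖dPot μ (cdiv M x - e κ) κ‖ ^ 2) :=
          Finset.sum_le_sum fun κ _ => Finset.sum_le_sum fun x _ => hpt κ x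
      _ = ∑ κ : Fin d, (2 * ((M : ℝ) ^ d * ∑ z ∈ periodBox (d := d) N, ‖dPot μ z κ‖ ^ 2)
            + 2 * ((M : ℝ) ^ d * ∑ z ∈ periodBox (d := d) N, ‖dPot μ (z - e κ) κ‖ ^ 2)) := by
          refine Finset.sum_congr rfl fun κ _ => ?_
          rw [Finset.sum_add_distrib, ← Finset.mul_sum, ← Finset.mul_sum,
            sum_comp_cdiv hM N (fun z => ‖dPot μ z κ‖ ^ 2), sum_comp_cdiv hM N (fun z => ‖dPot μ (z - e κ) κ‖ ^ 2)]
      _ = ∑ κ : Fin d, 4 * ((M : ℝ) ^ d * ∑ z ∈ periodBox (d := d) N, ‖dPot μ z κ‖ ^ 2) := by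
          refine Finset.sum_congr rfl fun κ _ => ?_
          rw [sum_periodBox_sub_e hN (g := fun z => ‖dPot μ z κ‖ ^ 2) (fun z τ => by simp only [hω]) κ]
          ring
      _ = 4 * (M : ℝ) ^ d * ∑ z ∈ periodBox (d := d) N, ∑ κ : Fin d, ‖dPot μ z κ‖ ^ 2 := by
          rw [Finset.sum_comm (s := periodBox (d := d) N), Finset.mul_sum]
          refine Finset.sum_congr rfl fun κ _ => ?_
          ring
  -- (e) conclude
  have h := sbound_arith hMd (c := (M : ℝ) ^ 2 / 2) (by positivity) (by positivity) hAΩ hAP hP2 hQ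
  refine h.trans (le_of_eq ?_)
  rw [pow_add]; ring

/-! ## §3 The END on the k-fold flat tangent space ∩ Landau: the Poincaré constant is 9, N-free -/

/-- On the k-fold flat tangent space the line sums are EXACT: `Σ_v Σ_{i<L^k} Y(L^k•z+v+i e_κ) κ = (L^k)^d • dPot (framePot L k Y) z κ`
(leaf-04's tiling `iterate_Qcoarse_apply` and structure theorem `iterate_Tcoarse_eq_zero_iff`). [folklore] -/
theorem lineSum_eq_of_iterate_Tcoarse_eq_zero {L : ℕ} (hL : 1 ≤ L) (k : ℕ) (Y : Site d → Fin d → ℂ)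
    (hT : (Tcoarse L)^[k] Y = 0) (z : Site d) (κ : Fin d) :
    ∑ v ∈ periodBox (d := d) (L ^ k), ∑ i ∈ range (L ^ k), Y (((L ^ k : ℕ) : ℤ) • z + v + (i : ℤ) • e κ) κ
      = ((((L ^ k : ℕ) : ℝ)) ^ d) • dPot (framePot L k Y) z κ := by
  have hQ : (Qcoarse L)^[k] Y = dPot (framePot L k Y) := (iterate_Tcoarse_eq_zero_iff hL k Y).mp hT
  have hMd : (0 : ℝ) < (((L ^ k : ℕ) : ℝ)) ^ d := by
    have : (0 : ℝ) < ((L ^ k : ℕ) : ℝ) := by exact_mod_cast Nat.pos_of_ne_zero (by positivity)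
    positivity
  have h := iterate_Qcoarse_apply hL k Y z κ
  rw [hQ] at h
  rw [h, smul_smul, mul_inv_cancel₀ (ne_of_gt hMd), one_smul]

/-- **BLOCK-POINCARÉ ON THE k-FOLD FLAT TANGENT SPACE ∩ LANDAU, N-FREE** (complex values): `L, N ≥ 1`, `Y` an `(L^k·N)`-periodic
complex 1-cochain with `(Tcoarse L)^[k] Y = 0` (k-fold tangent at the flat background) and `Σ_κ (Y x κ − Y (x − e_κ) κ) = 0`
(flat Landau).  Then `Σ_x Σ_κ ‖Y x κ‖² ≤ 9·(L^k)²·Σ_x Σ_κ Σ_μ ‖Y(x+e_μ) κ − Y x κ‖²` over `periodBox (L^k·N)` — k-free,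
L-free AND N-FREE (leaf-04's `sum_norm_sq_le_of_iterate_Tcoarse_eq_zero`: `5 + 2d·N²` without Landau). [folklore] -/
theorem sum_norm_sq_le_of_iterate_Tcoarse_eq_zero_of_flatDiv {L : ℕ} (hL : 1 ≤ L) {N : ℕ} (hN : 1 ≤ N) (k : ℕ)
    (Y : Site d → Fin d → ℂ) (hY : ∀ (x : Site d) (τ μ : Fin d), Y (x + ((L ^ k * N : ℕ) : ℤ) • e τ) μ = Y x μ)
    (hT : (Tcoarse L)^[k] Y = 0) (hdiv : ∀ x : Site d, ∑ κ : Fin d, (Y x κ - Y (x - e κ) κ) = 0) :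
    ∑ x ∈ periodBox (d := d) (L ^ k * N), ∑ κ : Fin d, ‖Y x κ‖ ^ 2
      ≤ 9 * ((L : ℝ) ^ k) ^ 2 * ∑ x ∈ periodBox (d := d) (L ^ k * N), ∑ κ : Fin d, ∑ μ : Fin d, ‖Y (x + e μ) κ - Y x κ‖ ^ 2 := by
  have hex := lineSum_eq_of_iterate_Tcoarse_eq_zero hL k Y hT
  set M : ℕ := L ^ k with hMdef
  have hM : 1 ≤ M := Nat.one_le_pow _ _ hL
  have hMN : 1 ≤ M * N := Nat.one_le_iff_ne_zero.mpr (Nat.mul_ne_zero (by omega) (by omega))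
  have hMR : ((L : ℝ) ^ k) = (M : ℝ) := by rw [hMdef]; push_cast; ring
  have hY' : ∀ (y : Site d) (τ μ : Fin d), Y (y + ((L : ℤ) ^ k * N) • e τ) μ = Y y μ := by
    intro y τ μ; have := hY y τ μ; push_cast at this; exact this
  have hμ : ∀ (z : Site d) (τ : Fin d), framePot L k Y (z + (N : ℤ) • e τ) = framePot L k Y z :=
    framePot_add_period L k Y hY'
  have hS := lineSum_sq_le_of_exact_of_flatDiv hM hN (framePot L k Y) Y hμ hY hex hdiv
  -- the diagonal gradient is at most the full gradient (periodic shift of each component)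
  have hdiagle : ∑ x ∈ periodBox (d := d) (M * N), ∑ κ : Fin d, ‖Y x κ - Y (x - e κ) κ‖ ^ 2
      ≤ ∑ x ∈ periodBox (d := d) (M * N), ∑ κ : Fin d, ∑ μ : Fin d, ‖Y (x + e μ) κ - Y x κ‖ ^ 2 := by
    calc ∑ x ∈ periodBox (d := d) (M * N), ∑ κ : Fin d, ‖Y x κ - Y (x - e κ) κ‖ ^ 2
        = ∑ κ : Fin d, ∑ x ∈ periodBox (d := d) (M * N), ‖Y x κ - Y (x - e κ) κ‖ ^ 2 := Finset.sum_comm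
      _ = ∑ κ : Fin d, ∑ x ∈ periodBox (d := d) (M * N), ‖Y (x + e κ) κ - Y x κ‖ ^ 2 := by
          refine Finset.sum_congr rfl fun κ _ => ?_
          have hper : ∀ (x : Site d) (τ : Fin d),
              ‖Y (x + ((M * N : ℕ) : ℤ) • e τ + e κ) κ - Y (x + ((M * N : ℕ) : ℤ) • e τ) κ‖ ^ 2
                = ‖Y (x + e κ) κ - Y x κ‖ ^ 2 := by
            intro x τ; rw [add_right_comm, hY, hY]
          rw [← sum_periodBox_shift (M * N) hMN (g := fun x => ‖Y (x + e κ) κ - Y x κ‖ ^ 2) hper (-e κ)]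
          refine Finset.sum_congr rfl fun x _ => ?_
          simp only [← sub_eq_add_neg, sub_add_cancel]
      _ ≤ ∑ κ : Fin d, ∑ x ∈ periodBox (d := d) (M * N), ∑ μ : Fin d, ‖Y (x + e μ) κ - Y x κ‖ ^ 2 :=
          Finset.sum_le_sum fun κ _ => Finset.sum_le_sum fun x _ =>
            Finset.single_le_sum (f := fun μ => ‖Y (x + e μ) κ - Y x κ‖ ^ 2) (fun _ _ => sq_nonneg _) (Finset.mem_univ κ)
      _ = ∑ x ∈ periodBox (d := d) (M * N), ∑ κ : Fin d, ∑ μ : Fin d, ‖Y (x + e μ) κ - Y x κ‖ ^ 2 := Finset.sum_comm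
  have hT1 : ∑ z ∈ periodBox (d := d) N, ∑ κ : Fin d,
      ‖∑ v ∈ periodBox (d := d) M, ∑ i ∈ range M, Y ((M : ℤ) • z + v + (i : ℤ) • e κ) κ‖ ^ 2
        ≤ 1 * ((M : ℝ) ^ d * (M : ℝ) ^ 4)
          * ∑ x ∈ periodBox (d := d) (M * N), ∑ κ : Fin d, ∑ μ : Fin d, ‖Y (x + e μ) κ - Y x κ‖ ^ 2 := by
    refine hS.trans ?_
    rw [one_mul, pow_add]
    exact mul_le_mul_of_nonneg_left hdiagle (by positivity)
  have h := sum_norm_sq_le_of_lineSum_sq_le hM hN Y hY hT1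
  rw [hMR]
  calc ∑ x ∈ periodBox (d := d) (M * N), ∑ κ : Fin d, ‖Y x κ‖ ^ 2
      ≤ (5 + 4 * 1) * (M : ℝ) ^ 2 * ∑ x ∈ periodBox (d := d) (M * N), ∑ κ : Fin d, ∑ μ : Fin d, ‖Y (x + e μ) κ - Y x κ‖ ^ 2 := h
    _ = 9 * (M : ℝ) ^ 2 * ∑ x ∈ periodBox (d := d) (M * N), ∑ κ : Fin d, ∑ μ : Fin d, ‖Y (x + e μ) κ - Y x κ‖ ^ 2 := by
        norm_num

end

end Summit.QuantumFields.BalabanUV.T4Continuum.NE3BlockPoincareLandau
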